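import Mathlib
import HarnessLib
import HarnessLib.Audit
import Summits.ValiantsHypothesis.Statement
import Literature.Computability.Complexity.Circuit
import Literature.Barriers.PneNP.MonotoneGap
import Literature.Computability.AlgebraicComplexity.ValiantConjectureProofs
import Summits.ValiantsHypothesis.ValiantsHypothesis.Theorems.HubHub
import HarnessLib.Audit.Status.Attr

/-!
Route: ShallowShadows

DORMANT since 2026-08-29T19:44:12Z (census g0: costume|duplicate of —; reader census-reader-27-g0) — unstaffed, not closed; items shared with open routes are served there. `ledger route dormant <id> --off` reactivates.

# Route ShallowShadows — easy counting forces shallow deciding — 0/1 VP polynomials cast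
monotone-shallow Boolean shadows, per's shadow is maximally deep

It suffices to show X = SHALLOW SHADOWS (card shallow-boolean-versions, spine; its thesis X in the
depth/formula form, calibrated by DEGREE):
there are δ > 0 and C such that for every p-family (f_n) in VP_ℂ all of whose coefficients lie in
{0,1}, the SHADOW (Boolean version)
B(f_n) : a ↦ [some monomial of f_n has support inside a] — a monotone Boolean function — has
monotone FORMULA size at most
2^{(deg f_n)^{1−δ}·(log(n+2))^C + C} eventually. B is a lattice homomorphism (+ ↦ ∨, × ↦ ∧) on
cancellation-free computations only; X says
that cancellations producing a 0/1 polynomial never buy a maximally deep shadow. FAR SIDE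
(Raz–Wigderson 1992, crux RazWigdersonMatching, the second binder of `closes`):
the shadow of per_m is bipartite perfect matching PM_m, whose monotone formula size is 2^{Ω(m)} =
2^{Ω(deg)} — maximal. Hence per ∉ VP_ℂ
and VP_ℂ ≠ VNP_ℂ. (The bolder CIRCUIT form — p-bounded monotone circuits for the shadows of 0/1 VP
families, far side Razborov 1985,
PROVED in the tree as `Razborov1985b_perfectMatching_holds` — and its planar-matching sentinel were
items here at open and were MOVED OUT by the
2026-08-17 route-repair: they do not feed `closes`, and an alternative deciding line is a sibling
route, not a rival family inside this one
(D-0019); their statements are kept under NOT DECOMPOSED YET for that sibling.)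
Lean: `∃ δ : ℝ, 0 < δ ∧ ∃ C : ℕ, ∀ (σ : ℕ → Type) [∀ n, Fintype (σ n)] [∀ n, DecidableEq (σ n)] (f :
∀ n, MvPolynomial (σ n) ℂ), Literature.Computability.AlgebraicComplexity.IsVPFamily f → (∀ (n : ℕ)
(m : σ n →₀ ℕ), (f n).coeff m = 0 ∨ (f n).coeff m = 1) → ∃ n₀ : ℕ, ∀ n ≥ n₀,
(Literature.Computability.Complexity.formulaSizeOver
Literature.Computability.Complexity.monotoneBasis (fun a : σ n → Bool => decide (∃ m ∈ (f
n).support, ∀ i ∈ m.support, a i = true)) : ℝ) ≤ 2 ^ (((f n).totalDegree : ℝ) ^ (1 - δ) * (Real.log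
(n + 2)) ^ C + C)`

## Assembly
Pure logic over proved tree facts: TransferKillsPer turns X + RazWigdersonMatching (+ the two per
facts) into ¬IsVPFamily(per_n over ℂ); the hub
`Summit.ValiantsHypothesis.Hub.valiantsHypothesis_of_not_isVPFamily_per` with the proved
`mem_VP_ofFintype_iff_holds` and `perFamily_mem_VNP_holds ℂ`
gives VP_ℂ ≠ VNP_ℂ. This is the deciding theorem `closes (h1 : ShadowFormulaTransfer) (hRW :
RazWigdersonMatching) : ValiantsHypothesis`, PROVED
sorry-free in this file with PerShadow / PerZeroOne / the degree of per_n / the analytic window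
inlined; the Assembly item restates it and is
provable now. Cone of `closes` after the 2026-08-17 repair: exactly the two cruxes; the supports
PerShadow, PerZeroOne, TransferKillsPer and
Assembly are by-name restatements of pieces of that proof (reusable lemmas, candidate proofs
attached as evidence), not extra hypotheses.

Rationale: WHY THIS LINE. A forgetful functor, not a restricted model: B forgets weights and multiplicities —
exactly what cancellations manipulate — and B(per_n) = B(det_n) =
PM_n, so the determinant can own a maximally deep shadow only by PAYING with negative coefficients
(Valiant1980; Jukna arXiv:1406.3065 Lemma 7 is
the monotone-only direction; CFM arXiv:2512.19515 Thm 1.4 kills the polynomial-loss transfer for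
NONNEGATIVE coefficients with P_M = Σ det(M[S])² x^S,
which has 0/1 coefficients only in the totally unimodular case, where the shadow is shallow by
Seymour). Imported: monotone Boolean complexity
(Razborov1985b, RazWigderson1992, CGRSS arXiv:2507.16105), Kasteleyn/Fisher Pfaffian methods and
planar separators (the consistency suite), regular
matroid decomposition. WINDOW (this route's calibration): in the number of variables N there is NO
window (PM_m costs 2^{Θ(√N)}, like every planar
family by separators), in the DEGREE d there is one — per is maximal (log L = Θ(d)) while every
catalogued cancellation-based 0/1 family
(planar/Pfaffian matchings, T-joins, TU bases, LGV) is planar-like or matroidal, log L = Õ(√d) or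
O(log² N); circuit SIZE calibrated to CGRSS
(2^{d^{1/3}}) is INVERTED against the separator bound 2^{√d} and is not used. No open or dead route
of this summit uses monotone BOOLEAN depth of
supports: the monotone-flavoured routes (MonotoneRestoration, DivisionGap, CirculantFourier,
FreeEnergyLift) transfer monotone ARITHMETIC size and are
hostage to the monotone gap, on all of whose witnesses (Valiant's planar matchings, Jerrum–Snir
spanning trees, CDGM, CFM) the shadow is shallow.

RANKED CRUXES. #2 ShadowFormulaTransfer (crux) — X itself (card K1, degree-calibrated formula form):
∃ δ>0, C: every 0/1-coefficient p-family f ∈ VP_ℂ has, eventually in n, monotone formula size of its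
shadow B(f_n) at most 2^{(deg f_n)^{1−δ}(log(n+2))^C + C}; best attacked in Valiant's normal form f
= Q − R (Q, R monotone-cheap, Q ≥ R coefficientwise) or over GKKS depth three. [difficulty:
open-problem] (why it might fail: A cancellation-born 0/1 VP family with an expander-like
(separator-free) shadow of KW-depth Ω(deg) kills it — e.g. a sign-coherent pair of TU matrices A,B
(det A_S·det B_S ∈ {0,1}) whose common-basis up-set is matching-hard; no structural reason beyond
the Pfaffian/TU census is known.) [RazWigderson1992, Valiant1980, arXiv:2512.19515, arXiv:1406.3065,
arXiv:2507.16105]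
#9 RazWigdersonMatching (crux — the FAR SIDE of X, retriaged support→crux 2026-08-16 as the second
binder of `closes`; a published theorem, the risk is formalisation debt, not truth) — Raz–Wigderson
1992 (JACM 39, Thm: monotone circuits for bipartite perfect matching require depth Ω(m),
equivalently monotone formulas of size 2^{Ω(m)}; quoted in arXiv:2507.16105 §1.2): ∃ c>0, m₀: for m
≥ m₀, 2^{c m} ≤ monotone formula size of perfectMatchingFn m. A published theorem to be formalised
(KW games + probabilistic CC of disjointness); the far side of X. [difficulty: XL]
[RazWigderson1992, arXiv:2507.16105, KarchmerWigderson1990] — PROVED 2026-08-26: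
`Theorems/ShallowShadowsRazWigdersonMatching.lean :: razWigdersonMatching_proof` (commit
4c3a28c2227d) closed stmt-ValiantsHypothesis-17127, so the FAR SIDE is a tree theorem and the cone
of `closes` has ONE open binder left, ShadowFormulaTransfer (stmt-ValiantsHypothesis-17124); nothing
below the far side remains to expand (tenure 2026-08-27).
#9 PerShadow (support) — the shadow of the permanent is the bipartite perfect matching function: for
every m and a, [∃ monomial of perPoly (Fin m) ℂ with support ⊆ a] = perfectMatchingFn m a (perPoly =
Σ_π Π_i X(π i, i), monomials ↔ permutations, π ↦ π⁻¹). [difficulty: provable-now] [Jukna2012,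
Razborov1985b, Burgisser2000]
#9 PerZeroOne (support) — every coefficient of perPoly (Fin m) ℂ is 0 or 1 (distinct permutations
give distinct monomials). [difficulty: provable-now] [Burgisser2000, Valiant1979]
#9 TransferKillsPer (support) — glue of the deciding theorem: X + Raz–Wigderson + PerShadow +
PerZeroOne ⇒ per is not a VP family over ℂ (instantiate X at σ n = Fin n × Fin n, f n = per_n, deg =
n, then c·n > n^{1−δ}(log(n+2))^C + C eventually contradicts 2^{cn} ≤ L ≤ 2^{…}; real-exponent
asymptotics only). [difficulty: provable-now] [RazWigderson1992, Burgisser2000]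

TWO-LAYER PLAN. TENURE 2026-08-27 (reaction to 17127 closing; ONE open crux left). (1) NO SPLIT of
ShadowFormulaTransfer is filed. The split foreseen at open — VNF (Valiant normal form: every 0/1 VP
family is Q − R with Q ≥ R monotone circuits) → DominationShallow (the up-set generated by {m : Q_m
> R_m} has monotone formulas of size 2^{d^{1−δ} polylog s}) → X — is WITHDRAWN as a decomposition:
its first piece is free (every arithmetic circuit of size s and formal degree d over ℂ is simulated
gate by gate by a 4-tuple of MONOTONE circuits (Re⁺, Re⁻, Im⁺, Im⁻) of size O(s) and the same formal
degree — binary products, (Q₁ − R₁)(Q₂ − R₂) = (Q₁Q₂ + R₁R₂) − (Q₁R₂ + R₁Q₂), sums componentwise —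
so every nonnegative-coefficient VP family is Q − R with Q ≥ R monotone of POLYNOMIAL size and
p-bounded degree, the folklore «one subtraction suffices», Valiant1980), and the shadow of Q − R IS
the up-set generated by {Q_m > R_m}; hence DominationShallow on pairs with 0/1 difference ≡ X, the
seam is modus ponens, one piece carries everything (D-0019 / BC2(c): not a redirect). This is the
crux record's finding too: the 2026-08-17 crux chain on 17124 (Cruxes/ShadowFormulaTransfer/: 7 crux
ideas, registered lines `birth` (= this VNF split; birth.md: DominationShallow is X reworded),
`det-kw` (VP → HasDetRepr 2^{17E²} PROVED ∧ KWFormula ∧ DetProtocol; DetProtocol ≡ X), `Sketch`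
(depth-3 chasm: Depth3Shadow, STRONGER than X), `Sketch-ideator1` (positivity certificates);
Disproof.lean; STRATEGY-CENSUS.md gen 0 / gen 1 / r1) typed the splits D-a…D-h and D-r1-a…d — regime
split (DNF piece trivial, window piece ≡ X), class split along the coherence dictionary
(Pfaffian-signable / TN-LGV / unimodular pieces provable, «the rest» ≡ X), cancellation-depth
filtration (X₁ ≡ X already), span-program and monotone-real sandwiches (far sides FALSE: 3Lin-SAT
span programs, Rosenbloom slices) — and found none with two pieces each strictly below X. Free
normalisations (WLOG homogeneous: B(f) = ⋁_k B(f^{(k)}), cost d + 1; VNF; the degree floor d ≤ (log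
n)^{(C−1)/δ} where X is the DNF bound) and the calibration lemmas — PfaffianShadows (planar
separators), TUShadows (Seymour), SpanningTreeShadows (Kirchhoff's 0/1 VP enumerator has shadow =
graph connectivity, monotone depth O(log² N)) — are `--supports ShadowFormulaTransfer` helper
lemmas, never items, never a third layer. (2) STRENGTH PLACEMENT, in tree since 2026-08-17
(Theorems/ShadowFormulaTransfer/Negative/): `SummitStrength.two_pow_rpow_lt_complexity_per :
ShadowFormulaTransfer → ∃ ε > 0, ∃ m₀, ∀ m ≥ m₀, 2^{m^ε} < L_ℂ(per_m)` and
`SummitStrength.not_isVQPFamily_per : ShadowFormulaTransfer → per ∉ VQP_ℂ` (the EXTENDED Valiant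
hypothesis, BCS Problem 21.5 — above the summit; proof: the padding normal form makes X's
(log(n+2))^C a polylog of CIRCUIT SIZE, `VarsCalibration`), next to
`FalseWithoutZeroOne.shadowFormulaTransfer_false_without_zeroOne / _with_unit_coefficients /
_without_VP` and `FalseOverCharTwo` (each hypothesis of X is load-bearing: det_m, unit coefficients,
characteristic 2 kill the variants). So the one open binder of `closes` is a certified strengthening
of a statement ABOVE VH with no separating witness possible short of EVH ∖ VH; three strategist
seats returned no-strategy-short-of-summit WITH census. (3) DISPOSITION recommended by this tenure
pass: 17124 stays the single rank-2 crux as typed (never reworded), but the route's live value is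
(a) the banked rungs — RazWigdersonMatching, PerShadow, PerZeroOne, TransferKillsPer, the Assembly,
the four lines' landed stubs, the Negative/ lemmas — and (b) the standing REFUTATION target ¬X of
KILL CRITERIA (a 0/1 VP family with a deep shadow would found a catalogued ShadowGap barrier); staff
it from the refuter / frontier budget (class-restricted rungs: UDiff, regular-matroid spanning,
read-once determinants, as the r1 census lists), and do NOT seat lead provers or a fourth crux chain
on X — a decision for the director / judge (dormant-or-frontier), recorded here so that the
2026-08-26 reactivation (caused by the far side landing, not by movement on X) is not read as
traction on X.

KILL CRITERIA. ¬ShadowFormulaTransfer (an explicit 0/1-coefficient VP family whose shadow needs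
monotone formulas 2^{deg^{1−o(1)}}) closes the route
`refuted:ShadowFormulaTransfer` — and founds a catalogued ShadowGap barrier. ¬RazWigdersonMatching
cannot happen (published theorem; a
formalisation gap would only delay). A refutation of the bolder circuit form (e.g. planar
non-bipartite matching needing n^{ω(1)} monotone
circuits, plus Kasteleyn for the triangulated grid) is informative for the sibling line but does NOT
touch this route: the circuit form and its
sentinel are no longer items here (moved out 2026-08-17), and X survives that witness by separators
(formulas 2^{Õ(√deg)}).
per ∉ VP proved elsewhere moots the route; X stays open as a statement about all 0/1 VP families.

NOT DECOMPOSED YET. (Tenure 2026-08-27: nothing to expand after 17127 — the far side is complete; no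
split of 17124 is filed, see TWO-LAYER PLAN.) The nonnegative-coefficient form X⁺ and CFM's
Gram-shadow question (card K2) — a live monotone-complexity race, not needed for VH; the
square-grid (bipartite planar) matching upper bound (card P1, circulation duality) and
regular-matroid shadows (card P2, Seymour) — calibration
lemmas, filed later as supports if a prover wants them; the planar ODD-FACTOR calibration (below) —
provable but needs planar duality on grids in
Lean; the constant δ (any δ < 1/2 is consistent with the separator census; the assembly needs only δ
> 0); Boolean-version DEFINITIONS
(booleanVersion, monotone depth) are inlined, no definition item blocks anything. MOVED OUT BY THE
2026-08-17 ROUTE-REPAIR (unused-crux; kept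
here as the record for a sibling route, not items of this one): (a) the CIRCUIT FORM, ex-item
ShadowCircuitPoly (ledger stmt-ValiantsHypothesis-17125,
grounded NEW/open): `∀ (σ : ℕ → Type) [∀ n, Fintype (σ n)] [∀ n, DecidableEq (σ n)] (f : ∀ n,
MvPolynomial (σ n) ℂ), IsVPFamily f → (∀ n m, (f n).coeff
m = 0 ∨ (f n).coeff m = 1) → IsPBounded (fun n => circuitSizeOver monotoneBasis (shadow of f n))` —
with the IN-TREE Razborov1985b_perfectMatching_holds
it decides VH with no literature debt (deciding theorem `closes_circuit : ShadowCircuitPoly →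
ValiantsHypothesis` checked rc 0 by the 2026-08-16
repair planner, evidence ShallowShadowsCircuitGlue.lean on this route); it neither implies nor
follows from X (poly circuit size vs
2^{deg^{1−δ}·polylog} formula size), so it cannot be glued into `closes` honestly and is a ONE-crux
sibling line (BC1: needs the human's keep, or a
second genuine crux such as a Valiant-normal-form split); (b) its SENTINEL, ex-item
TriangularMatchingMonotone (stmt-ValiantsHypothesis-17126, grounded
open-in-print, CFM arXiv:2512.19515 §1.3): perfect-matching existence in subgraphs of the k×k
triangulated grid has monotone circuits of size
k^{O(1)} — the kill path of (a) via Kasteleyn, irrelevant to X (that family is formula-shallow by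
separators whatever its circuit complexity); (c)
the glue ex-item PolyTransferKillsPer (stmt-ValiantsHypothesis-17131), dropped with (a) because its
statement names ShadowCircuitPoly.

CHEAPEST FALSIFIER. Hunt a 0/1 VP family with a deep shadow among cancellation-based mechanisms: (i)
planar/Pfaffian matchings — shallow by separators (formulas
2^{Õ(√V)}, depth Õ(√deg)); (ii) TU/regular-matroid bases — connectivity-type, depth O(log² N); (iii)
CHECKED THIS SESSION: planar T-join /
odd-factor enumerators Σ_{∂J=T} x^J of a plane graph are 0/1 VP families (x^{J₀}·E_G with x_e ↦
1/x_e on a fixed T-join J₀, E_G the Kasteleyn–Fisher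
even-subgraph Pfaffian) whose shadows are PLANAR ODD-FACTOR functions; on general graphs odd factor
needs monotone formulas 2^{Ω(n)} (Babai–Gál–
Wigderson, arXiv:2507.16105 §1.2), but on a plane graph it has POLY monotone circuits: B fails iff a
dual cycle avoiding A* encloses an odd number of
T-vertices = an unbalanced cycle of a fixed Z/2-voltage graph, detected by connectivity of the
voltage double cover, and B is the De Morgan dual of
that monotone function — so planar T-joins threaten neither X nor the circuit form; planar
NON-bipartite matching is formula-shallow for X by
separators and open only for the (moved-out) circuit form; (iv) sign-coherent TU pairs — none known.
CFM arXiv:2512.19515 §1.3 lists planar matching and "log-depth P with hard f_P" as OPEN.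

NUMBERS. PM_m: monotone formula size 2^{Θ(m)} (RazWigderson1992; upper bound 2^m·poly via Hall),
monotone circuits ≥ m^{(log m)/100} for ln m ≥ 4000
(in tree, Razborov1985b_perfectMatching_holds) and ≥ 2^{m^{1/3−o(1)}} (arXiv:2507.16105 Thm 1);
per_m: degree m, m² variables, 0/1
coefficients. Planar families: separators give monotone formulas 2^{Õ(√V)}, degree Θ(V). CFM P_M:
circuits n^{Ω(√log n)}, coefficients
det(M[S])² (not 0/1). Trivial DNF bound for any degree-d f on N variables: log L ≤ d·log N + O(log
d); X demands log L ≤ d^{1−δ}(log n)^C — a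
polynomial saving in the exponent, forced only when d ≥ polylog. Items: 9 at open (3 cruxes, 5
supports, 1 assembly); 6 after the 2026-08-17 repair (2 cruxes = X and its far side, both binders of
`closes`; 3 supports; 1 assembly); since 2026-08-26 ONE open item: crux 17124 (17127
RazWigdersonMatching, the 3 supports and the assembly are closed `proved`).

DEFINITION REQUESTS. booleanVersion (Literature/Computability/Complexity): `fun (f : MvPolynomial σ
R) (a : σ → Bool) => decide (∃ m ∈ f.support, ∀ i ∈ m.support, a i = true)`
(inlined in every item now); monotoneFormulaDepth / a balanced-formula lemma (formula size L ⇒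
monotone depth O(log L)) for the depth reading of X.
Both filed with `ledger workitem add --kind definition` after open; no item depends on them.

Novelty: Searches (2026-08-16): `lit frontier ValiantsHypothesis --since 2024` (30 rows; read
arXiv:2601.09343 symmetric classes/hom polynomials,
arXiv:2601.00387 τ via exponential sums, arXiv:2506.23214 — none on Boolean shadows); `lit read
arXiv:2507.16105` (§1, §1.2: RW92 and
Babai–Gál–Wigderson for odd factor), `lit read arXiv:2512.19515` (Thm 1.4, §1.3 open problems); `lit
galaxy search --star all` ×5 ("Boolean
version of a polynomial", "monotone arithmetic circuit lower bounds via the Boolean", "negation can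
be exponentially powerful" → Wegener's book
only, "monotone circuits for matching require linear depth", "odd factor") — 0 relevant beyond the
above; `lit search` local tier down
(searchd connection reset), OpenAlex/S2 daily budget exhausted, arXiv API 0 rows; `ledger
negatives`; all 68 Theses files of the sub grepped by
title/mechanism (no route uses monotone Boolean depth/size of supports); 135 idea cards scanned
(spine card shallow-boolean-versions by
ideator-25 is the only one; positive-orthant-sign-elimination / newton-xc-nonneg /
division-closes-monotone-gap / free-energy-convex-lift are
other functors on VP⁺).
Nearest prior art found: arXiv:2512.19515 (defines f_P, proves Thm 1.4 — the nonnegative poly-loss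
gap — and asks the planar-matching and
log-depth questions, but states no transfer and draws nothing toward VP ≠ VNP); arXiv:1406.3065
Lemma 7 and Valiant1980 (monotone-only
direction); RazWigderson1992 + arXiv:2507.16105 (far side); in-hub card shallow-boolean-ver  [refs: 2601.09343, 2601.00387, 2506.23214, 2507.16105, 2512.19515, 1406.3065, Valiant1980, RazWigderson1992]

Barriers (technique_class: monotone-boolean-shadow, kw-depth-transfer, positivity): - technique_class: monotone-boolean-shadow, kw-depth-transfer, positivity
- Literature.Barriers.ValiantsHypothesis.MonotoneGap: evaded by changing the conclusion from
monotone ARITHMETIC size to monotone BOOLEAN formula size of the support up-set, checked on every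
catalogued gap witness (Valiant 1980 planar matchings: separators; Jerrum–Snir/CDGM spanning trees:
connectivity O(n³); CFM P_n: poly formula; CFM P_M: not 0/1); the ε-sensitive part
(MonotoneGapSensitive, SensitiveDiscrepancy) concerns F ± ε g inside the arithmetic model and B
forgets ε.
- Literature.Barriers.ValiantsHypothesis.AlgebraicNaturalProofs: the property "0/1 coefficients ∧
deep shadow" is a sign/support condition of measure zero, neither a vanishing polynomial nor large;
FSV/GKSS do not apply (conceded: a proof of rank 2 may use rank arguments on monotone KW games,
which are Boolean and outside FSV's setting).
- Literature.Barriers.ValiantsHypothesis.PermanentCharTwo: respected — positivity needs an ordered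
field; over F₂ det is a 0/1 polynomial with a maximal shadow and X is false there, as it must be;
every item is over ℂ.
- Literature.Barriers.ValiantsHypothesis.RankMethods: no flattening or coefficient-matrix rank of f
is used; per and det have identical supports and shadows and are separated only by sign, which no
rank of a linear image of f sees (same for PartialDerivativesDetPerm, FullRankMultilinear,
ShiftedPartialDerivatives).
- Literature.Barriers.ValiantsHypothesis.DepthReductionChasm: used as

History (route lifecycle, newest last):
- 2026-08-17T08:36:42Z · rev 3: dropped ShadowCircuitPoly, TriangularMatchingMonotone, PolyTransferKillsPer — route-repair (unused-crux, views3 cone): DROP ShadowCircuitPoly (#3, circuit form) and TriangularMatchingMonotone (#4, its sentinel) — neither feeds `closes` (b (planner-rrepair-ValiantsHypothesis-ShallowShad-23e06685-0)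
- 2026-08-24T18:46:55Z · DORMANT — reconciler: no traction for 7 d (last activity item-evidence-added at 2026-08-17T18:33:30Z); parked, not closed — `ledger route dormant route-ValiantsHypothesis (operator:999:3581849)
- 2026-08-26T06:37:38Z · REACTIVATED — reconciler: reactivated — activity item-proof-filed at 2026-08-26T06:11:08Z after parking at 2026-08-24T18:46:55Z (operator:999:691594)
- 2026-08-29T19:44:12Z · DORMANT — census g0: costume|duplicate of —; reader census-reader-27-g0 (operator:999:1851367)

sub-problem: ValiantsHypothesis · status: dormant · opened operator:999:932126 2026-08-16T22:31:54Z · rev 4 · ledger route-ValiantsHypothesis-ShallowShadows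
GENERATED by the gate from the ledger (D-0016/17). Provers cite these decls: `theorem foo : Summit.ValiantsHypothesis.ValiantsHypothesis.Theses.ShallowShadows.<Decl> := …` in Summits/ValiantsHypothesis/ValiantsHypothesis/Theorems/<Name>.lean.
-/

namespace Summit.ValiantsHypothesis.ValiantsHypothesis.Theses.ShallowShadows

open scoped BigOperators Topology Manifold Classical MeasureTheory ProbabilityTheory Matrix InnerProductSpace ComplexConjugate ContinuousMap
open Filter Set Function TopologicalSpace MeasureTheory

attribute [summit_statement] _root_.ValiantsHypothesis

open Literature.PNP

/-- item stmt-ValiantsHypothesis-17124 · crux · rank 2 · open · by operator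
why it might fail: A cancellation-born 0/1 VP family with an expander-like (separator-free) shadow of KW-depth Ω(deg) kills it — e.g. a sign-coherent pair of TU matrices A,B (det A_S·det B_S ∈ {0,1}) whose common-basis up-set is matching-hard; no structural reason beyond the Pfaffian/TU census is known.
sources: RazWigderson1992, Valiant1980, arXiv:2512.19515, arXiv:1406.3065, arXiv:2507.16105
[crux] X itself (card K1, degree-calibrated formula form): ∃ δ>0, C: every 0/1-coefficient p-family
f ∈ VP_ℂ has, eventually in n, monotone formula size of its shadow B(f_n) at most 2^{(deg
f_n)^{1−δ}(log(n+2))^C + C}; best attacked in Valiant's normal form f = Q − R (Q, R monotone-cheap,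
Q ≥ R coefficientwise) or over GKKS depth three. [difficulty: open-problem] -/
@[route_item "route-ValiantsHypothesis-ShallowShadows", crux]
def ShadowFormulaTransfer : Prop :=
  ∃ δ : ℝ, 0 < δ ∧ ∃ C : ℕ, ∀ (σ : ℕ → Type) [∀ n, Fintype (σ n)] [∀ n, DecidableEq (σ n)] (f : ∀ n, MvPolynomial (σ n) ℂ), Literature.Computability.AlgebraicComplexity.IsVPFamily f → (∀ (n : ℕ) (m : σ n →₀ ℕ), (f n).coeff m = 0 ∨ (f n).coeff m = 1) → ∃ n₀ : ℕ, ∀ n ≥ n₀, (Literature.Computability.Complexity.formulaSizeOver Literature.Computability.Complexity.monotoneBasis (fun a : σ n → Bool => decide (∃ m ∈ (f n).support, ∀ i ∈ m.support, a i = true)) : ℝ) ≤ 2 ^ (((f n).totalDegree : ℝ) ^ (1 - δ) * (Real.log (n + 2)) ^ C + C)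

/-- item stmt-ValiantsHypothesis-17127 · crux · rank 9 · closed · proved by Summit.ValiantsHypothesis.ValiantsHypothesis.Theorems.ShallowShadowsRazWigdersonMatching.razWigdersonMatching_proof @ 5f137310b8fb (prover) · by operator
why it might fail: Published theorem (Raz–Wigderson 1992: monotone depth Ω(m) for bipartite matching, so monotone formulas 2^{Ω(m)}, via randomized CC of disjointness); risks: formalisation size (KW games + probabilistic CC) and matching the paper's formula model to formulaSizeOver/monotoneBasis up to the constant c.
sources: RazWigderson1992, arXiv:2507.16105, KarchmerWigderson1990
[support] Raz–Wigderson 1992 (JACM 39, Thm: monotone circuits for bipartite perfect matching require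
depth Ω(m), equivalently monotone formulas of size 2^{Ω(m)}; quoted in arXiv:2507.16105 §1.2): ∃
c>0, m₀: for m ≥ m₀, 2^{c m} ≤ monotone formula size of perfectMatchingFn m. A published theorem to
be formalised (KW games + probabilistic CC of disjointness); the far side of X. [difficulty: XL] -/
@[route_item "route-ValiantsHypothesis-ShallowShadows", crux]
def RazWigdersonMatching : Prop :=
  ∃ c : ℝ, 0 < c ∧ ∃ m₀ : ℕ, ∀ m ≥ m₀, (2 : ℝ) ^ (c * m) ≤ Literature.Computability.Complexity.formulaSizeOver Literature.Computability.Complexity.monotoneBasis (Literature.Barriers.PneNP.perfectMatchingFn m)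

-- `RazWigdersonMatching` holds: proved by `Summit.ValiantsHypothesis.ValiantsHypothesis.Theorems.ShallowShadowsRazWigdersonMatching.razWigdersonMatching_proof` @ 5f137310b8fb (its module imports this route file, so no `_holds` link can be stated here).

/-- item stmt-ValiantsHypothesis-17128 · support · rank 9 · closed · proved by Summit.ValiantsHypothesis.ValiantsHypothesis.Theorems.ShallowShadows.perShadow_proof (prover) · by operator
sources: Jukna2012, Razborov1985b, Burgisser2000
[support] the shadow of the permanent is the bipartite perfect matching function: for every m and a,
[∃ monomial of perPoly (Fin m) ℂ with support ⊆ a] = perfectMatchingFn m a (perPoly = Σ_π Π_i X(π i,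
i), monomials ↔ permutations, π ↦ π⁻¹). [difficulty: provable-now] -/
@[route_item "route-ValiantsHypothesis-ShallowShadows"]
def PerShadow : Prop :=
  ∀ (m : ℕ) (a : Fin m × Fin m → Bool), decide (∃ mo ∈ (Literature.Computability.AlgebraicComplexity.perPoly (Fin m) ℂ).support, ∀ i ∈ mo.support, a i = true) = Literature.Barriers.PneNP.perfectMatchingFn m a

-- `PerShadow` holds: proved by `Summit.ValiantsHypothesis.ValiantsHypothesis.Theorems.ShallowShadows.perShadow_proof` (its module imports this route file, so no `_holds` link can be stated here).

/-- item stmt-ValiantsHypothesis-17129 · support · rank 9 · closed · proved by Summit.ValiantsHypothesis.ValiantsHypothesis.Theorems.ShallowShadows.perZeroOne_proof (prover) · by operator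
sources: Burgisser2000, Valiant1979
[support] every coefficient of perPoly (Fin m) ℂ is 0 or 1 (distinct permutations give distinct
monomials). [difficulty: provable-now] -/
@[route_item "route-ValiantsHypothesis-ShallowShadows"]
def PerZeroOne : Prop :=
  ∀ (m : ℕ) (mo : Fin m × Fin m →₀ ℕ), (Literature.Computability.AlgebraicComplexity.perPoly (Fin m) ℂ).coeff mo = 0 ∨ (Literature.Computability.AlgebraicComplexity.perPoly (Fin m) ℂ).coeff mo = 1

-- `PerZeroOne` holds: proved by `Summit.ValiantsHypothesis.ValiantsHypothesis.Theorems.ShallowShadows.perZeroOne_proof` (its module imports this route file, so no `_holds` link can be stated here).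

/-- item stmt-ValiantsHypothesis-17130 · support · rank 9 · closed · proved by Summit.ValiantsHypothesis.ValiantsHypothesis.Theorems.ShallowShadows.transferKillsPer_proof (prover) · by operator
sources: RazWigderson1992, Burgisser2000
[support] glue of the deciding theorem: X + Raz–Wigderson + PerShadow + PerZeroOne ⇒ per is not a VP
family over ℂ (instantiate X at σ n = Fin n × Fin n, f n = per_n, deg = n, then c·n >
n^{1−δ}(log(n+2))^C + C eventually contradicts 2^{cn} ≤ L ≤ 2^{…}; real-exponent asymptotics only).
[difficulty: provable-now] -/
@[route_item "route-ValiantsHypothesis-ShallowShadows"]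
def TransferKillsPer : Prop :=
  ShadowFormulaTransfer → RazWigdersonMatching → PerShadow → PerZeroOne → ¬ Literature.Computability.AlgebraicComplexity.IsVPFamily (fun n => Literature.Computability.AlgebraicComplexity.perPoly (Fin n) ℂ)

-- `TransferKillsPer` holds: proved by `Summit.ValiantsHypothesis.ValiantsHypothesis.Theorems.ShallowShadows.transferKillsPer_proof` (its module imports this route file, so no `_holds` link can be stated here).

/-- item stmt-ValiantsHypothesis-17132 · assembly · rank 1 · closed · proved by Summit.ValiantsHypothesis.ValiantsHypothesis.Theorems.ShallowShadowsAssemblyProof.assembly_proof (prover) · by operator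
sources: Valiant1979, Burgisser2000
[assembly] ShadowFormulaTransfer → RazWigdersonMatching → PerShadow → PerZeroOne → TransferKillsPer
→ ValiantsHypothesis. -/
@[route_item "route-ValiantsHypothesis-ShallowShadows"]
def Assembly : Prop :=
  ShadowFormulaTransfer → RazWigdersonMatching → PerShadow → PerZeroOne → TransferKillsPer → _root_.ValiantsHypothesis

-- `Assembly` holds: proved by `Summit.ValiantsHypothesis.ValiantsHypothesis.Theorems.ShallowShadowsAssemblyProof.assembly_proof` (its module imports this route file, so no `_holds` link can be stated here).

/-! D-0027 §2.1 — DECIDING THEOREM (planner-authored via `route open/edit --closes-file`; by operator:999:1181366 2026-08-16T22:37:52Z):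
its hypotheses are this route's items and its conclusion the sub-problem Statement (glue_lint), and it elaborates with this file. -/

@[closes "route-ValiantsHypothesis-ShallowShadows"] theorem closes (h1 : ShadowFormulaTransfer) (hRW : RazWigdersonMatching) : _root_.ValiantsHypothesis := by
  -- Notation inside this proof: for a permutation σ of Fin m, its exponent vector is
  -- E σ := ∑ i, Finsupp.single (σ i, i) 1, with entry 1 at (σ b, b) and 0 elsewhere.
  have permExp_apply : ∀ {m : ℕ} (σ : Equiv.Perm (Fin m)) (p : Fin m × Fin m),
      (∑ i : Fin m, Finsupp.single (σ i, i) (1 : ℕ)) p = if σ p.2 = p.1 then 1 else 0 := by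
    intro m σ p
    rw [Finsupp.finset_sum_apply, Finset.sum_eq_single p.2]
    · simp only [Finsupp.single_apply]
      by_cases h : σ p.2 = p.1
      · simp [h, Prod.ext_iff]
      · simp only [h, if_false]
        rw [if_neg]
        intro h'
        exact h (by rw [Prod.ext_iff] at h'; exact h'.1)
    · intro b _ hb
      simp only [Finsupp.single_apply]
      rw [if_neg]
      intro h'
      rw [Prod.ext_iff] at h'
      exact hb h'.2
    · intro h; exact absurd (Finset.mem_univ _) h
  have permExp_injective : ∀ {m : ℕ} (σ τ : Equiv.Perm (Fin m)),
      (∑ i : Fin m, Finsupp.single (σ i, i) (1 : ℕ)) = (∑ i : Fin m, Finsupp.single (τ i, i) (1 : ℕ)) → σ = τ := by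
    intro m σ τ h
    refine Equiv.ext fun b => ?_
    have := congrArg (fun e => e (σ b, b)) h
    simp only [permExp_apply] at this
    simp only [if_true] at this
    by_contra hne
    rw [if_neg] at this
    · exact one_ne_zero this
    · intro h'; exact hne h'.symm
  have perPoly_eq_sum : ∀ m : ℕ, Literature.Computability.AlgebraicComplexity.perPoly (Fin m) ℂ =
      ∑ σ : Equiv.Perm (Fin m), MvPolynomial.monomial (∑ i : Fin m, Finsupp.single (σ i, i) 1) (1 : ℂ) := by
    intro m
    unfold Literature.Computability.AlgebraicComplexity.perPoly Matrix.permanent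
    refine Finset.sum_congr rfl fun σ _ => ?_
    rw [MvPolynomial.monomial_sum_one]
    refine Finset.prod_congr rfl fun i _ => ?_
    rfl
  have coeff_perPoly : ∀ (m : ℕ) (mo : Fin m × Fin m →₀ ℕ),
      (Literature.Computability.AlgebraicComplexity.perPoly (Fin m) ℂ).coeff mo =
        ((Finset.univ.filter fun σ : Equiv.Perm (Fin m) =>
          (∑ i : Fin m, Finsupp.single (σ i, i) (1 : ℕ)) = mo).card : ℂ) := by
    intro m mo
    rw [perPoly_eq_sum, MvPolynomial.coeff_sum]
    simp only [MvPolynomial.coeff_monomial]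
    rw [Finset.sum_boole]
  have card_le_one : ∀ (m : ℕ) (mo : Fin m × Fin m →₀ ℕ),
      (Finset.univ.filter fun σ : Equiv.Perm (Fin m) =>
        (∑ i : Fin m, Finsupp.single (σ i, i) (1 : ℕ)) = mo).card ≤ 1 := by
    intro m mo
    refine Finset.card_le_one.mpr ?_
    intro σ hσ τ hτ
    simp only [Finset.mem_filter, Finset.mem_univ, true_and] at hσ hτ
    exact permExp_injective σ τ (hσ.trans hτ.symm)
  have coeff01 : ∀ (m : ℕ) (mo : Fin m × Fin m →₀ ℕ),
      (Literature.Computability.AlgebraicComplexity.perPoly (Fin m) ℂ).coeff mo = 0 ∨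
      (Literature.Computability.AlgebraicComplexity.perPoly (Fin m) ℂ).coeff mo = 1 := by
    intro m mo
    rw [coeff_perPoly]
    rcases Nat.le_one_iff_eq_zero_or_eq_one.mp (card_le_one m mo) with h0 | h0
    · left; rw [h0]; simp
    · right; rw [h0]; simp
  have mem_support_perPoly : ∀ (m : ℕ) (mo : Fin m × Fin m →₀ ℕ),
      mo ∈ (Literature.Computability.AlgebraicComplexity.perPoly (Fin m) ℂ).support ↔
        ∃ σ : Equiv.Perm (Fin m), (∑ i : Fin m, Finsupp.single (σ i, i) (1 : ℕ)) = mo := by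
    intro m mo
    rw [MvPolynomial.mem_support_iff, coeff_perPoly]
    constructor
    · intro h
      have : (Finset.univ.filter fun σ : Equiv.Perm (Fin m) =>
          (∑ i : Fin m, Finsupp.single (σ i, i) (1 : ℕ)) = mo).card ≠ 0 := by
        intro h0; apply h; rw [h0]; simp
      obtain ⟨σ, hσ⟩ := Finset.card_ne_zero.mp this
      simp only [Finset.mem_filter, Finset.mem_univ, true_and] at hσ
      exact ⟨σ, hσ⟩
    · rintro ⟨σ, rfl⟩
      have : (Finset.univ.filter fun τ : Equiv.Perm (Fin m) =>
          (∑ i : Fin m, Finsupp.single (τ i, i) (1 : ℕ)) = ∑ i : Fin m, Finsupp.single (σ i, i) (1 : ℕ)).card ≠ 0 := by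
        apply Finset.card_ne_zero.mpr
        exact ⟨σ, by simp⟩
      exact_mod_cast this
  have mem_support_permExp : ∀ {m : ℕ} (σ : Equiv.Perm (Fin m)) (p : Fin m × Fin m),
      p ∈ (∑ i : Fin m, Finsupp.single (σ i, i) (1 : ℕ)).support ↔ σ p.2 = p.1 := by
    intro m σ p
    rw [Finsupp.mem_support_iff, permExp_apply]
    by_cases h : σ p.2 = p.1 <;> simp [h]
  have shadow_iff : ∀ (m : ℕ) (a : Fin m × Fin m → Bool),
      (∃ mo ∈ (Literature.Computability.AlgebraicComplexity.perPoly (Fin m) ℂ).support, ∀ i ∈ mo.support, a i = true) ↔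
        ∃ σ : Equiv.Perm (Fin m), ∀ i, a (i, σ i) = true := by
    intro m a
    constructor
    · rintro ⟨mo, hmo, ha⟩
      obtain ⟨σ, rfl⟩ := (mem_support_perPoly m mo).mp hmo
      refine ⟨σ.symm, fun i => ?_⟩
      have hmem : (i, σ.symm i) ∈ (∑ i : Fin m, Finsupp.single (σ i, i) (1 : ℕ)).support := by
        rw [mem_support_permExp]; simp
      exact ha _ hmem
    · rintro ⟨τ, hτ⟩
      refine ⟨∑ i : Fin m, Finsupp.single (τ.symm i, i) (1 : ℕ),
        (mem_support_perPoly m _).mpr ⟨τ.symm, rfl⟩, fun p hp => ?_⟩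
      rw [mem_support_permExp] at hp
      have : p = (p.1, τ p.1) := by
        ext
        · rfl
        · simp only
          rw [← hp]; simp
      rw [this]; exact hτ p.1
  have shadow_eq : ∀ m : ℕ,
      (fun a : Fin m × Fin m → Bool => decide (∃ mo ∈ (Literature.Computability.AlgebraicComplexity.perPoly (Fin m) ℂ).support,
        ∀ i ∈ mo.support, a i = true)) = Literature.Barriers.PneNP.perfectMatchingFn m := by
    intro m
    funext a
    unfold Literature.Barriers.PneNP.perfectMatchingFn
    exact decide_eq_decide.mpr (shadow_iff m a)
  have sum_permExp : ∀ {m : ℕ} (σ : Equiv.Perm (Fin m)),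
      ∑ p : Fin m × Fin m, (∑ i : Fin m, Finsupp.single (σ i, i) (1 : ℕ)) p = m := by
    intro m σ
    simp_rw [permExp_apply]
    rw [Fintype.sum_prod_type_right]
    simp
  have totalDegree_perPoly : ∀ m : ℕ, (Literature.Computability.AlgebraicComplexity.perPoly (Fin m) ℂ).totalDegree = m := by
    intro m
    apply le_antisymm
    · rw [perPoly_eq_sum]
      refine (MvPolynomial.totalDegree_finset_sum _ _).trans ?_
      refine Finset.sup_le fun σ _ => ?_
      refine (MvPolynomial.totalDegree_monomial_le _ _).trans ?_
      rw [Finsupp.sum_fintype _ _ (fun _ => rfl)]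
      exact (sum_permExp σ).le
    · have hmem : (∑ i : Fin m, Finsupp.single ((1 : Equiv.Perm (Fin m)) i, i) (1 : ℕ)) ∈
          (Literature.Computability.AlgebraicComplexity.perPoly (Fin m) ℂ).support :=
        (mem_support_perPoly m _).mpr ⟨1, rfl⟩
      have := MvPolynomial.le_totalDegree hmem
      rw [Finsupp.sum_fintype _ _ (fun _ => rfl)] at this
      rwa [sum_permExp] at this
  -- the analytic window: x^{1-δ} (log (x+2))^C + C < c·x eventually
  have eventually_window : ∀ (δ : ℝ), 0 < δ → ∀ (C : ℕ) (c : ℝ), 0 < c →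
      ∀ᶠ x : ℝ in atTop, x ^ (1 - δ) * Real.log (x + 2) ^ C + C < c * x := by
    intro δ hδ C c hc
    have hlo := isLittleO_log_rpow_rpow_atTop (C : ℝ) hδ
    have hε : 0 < c / 2 ^ (C + 2) := by positivity
    filter_upwards [hlo.def hε, eventually_ge_atTop (2 : ℝ), eventually_gt_atTop (4 * C / c + 1)] with x hx hx2 hxC
    have hx0 : 0 < x := by linarith
    have hlog2 : Real.log (x + 2) ≤ 2 * Real.log x := by
      have hsq : x + 2 ≤ x ^ 2 := by nlinarith
      calc Real.log (x + 2) ≤ Real.log (x ^ 2) := Real.log_le_log (by linarith) hsq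
        _ = 2 * Real.log x := by rw [Real.log_pow]; norm_num
    have hlog0 : 0 ≤ Real.log (x + 2) := Real.log_nonneg (by linarith)
    have hlogx0 : 0 ≤ Real.log x := Real.log_nonneg (by linarith)
    have hpowC : Real.log (x + 2) ^ C ≤ 2 ^ C * Real.log x ^ C := by
      calc Real.log (x + 2) ^ C ≤ (2 * Real.log x) ^ C := pow_le_pow_left₀ hlog0 hlog2 C
        _ = 2 ^ C * Real.log x ^ C := by rw [mul_pow]
    have hxδ0 : 0 < x ^ δ := Real.rpow_pos_of_pos hx0 δ
    have hlo' : Real.log x ^ C ≤ c / 2 ^ (C + 2) * x ^ δ := by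
      have := hx
      rw [Real.norm_of_nonneg (by positivity), Real.norm_of_nonneg hxδ0.le] at this
      rwa [Real.rpow_natCast] at this
    have hx1δ0 : 0 < x ^ (1 - δ) := Real.rpow_pos_of_pos hx0 _
    have hsplit : x ^ (1 - δ) * x ^ δ = x := by
      rw [← Real.rpow_add hx0]; norm_num
    have hconst : (2 : ℝ) ^ C * (c / 2 ^ (C + 2)) = c / 4 := by
      rw [pow_add]; field_simp; ring
    have hmain : x ^ (1 - δ) * Real.log (x + 2) ^ C ≤ c / 4 * x := by
      calc x ^ (1 - δ) * Real.log (x + 2) ^ C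
          ≤ x ^ (1 - δ) * (2 ^ C * (c / 2 ^ (C + 2) * x ^ δ)) := by
            apply mul_le_mul_of_nonneg_left _ hx1δ0.le
            exact hpowC.trans (mul_le_mul_of_nonneg_left hlo' (by positivity))
        _ = (2 ^ C * (c / 2 ^ (C + 2))) * (x ^ (1 - δ) * x ^ δ) := by ring
        _ = c / 4 * x := by rw [hconst, hsplit]
    have hCx : (C : ℝ) < c / 4 * x := by
      have : 4 * (C : ℝ) / c < x - 1 := by linarith
      have h4 : 4 * (C : ℝ) < (x - 1) * c := by
        rwa [div_lt_iff₀ hc] at this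
      nlinarith
    nlinarith
  -- per is not a VP family: otherwise X bounds the shadow of per_n (= PM_n) below Raz–Wigderson's 2^{c n}
  have hnotVP : ¬ Literature.Computability.AlgebraicComplexity.IsVPFamily
      (fun n => Literature.Computability.AlgebraicComplexity.perPoly (Fin n) ℂ) := by
    intro hVP
    obtain ⟨δ, hδ, C, hC⟩ := h1
    obtain ⟨n₀, hn₀⟩ := hC (fun n => Fin n × Fin n)
      (fun n => Literature.Computability.AlgebraicComplexity.perPoly (Fin n) ℂ) hVP (fun n mo => coeff01 n mo)
    obtain ⟨c, hc, m₀, hm₀⟩ := hRW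
    obtain ⟨N, hN⟩ := eventually_atTop.mp
      ((tendsto_natCast_atTop_atTop (R := ℝ)).eventually (eventually_window δ hδ C c hc))
    let n : ℕ := max (max n₀ m₀) N
    have hn₀' : n₀ ≤ n := (le_max_left _ _).trans (le_max_left _ _)
    have hm₀' : m₀ ≤ n := (le_max_right _ _).trans (le_max_left _ _)
    have hN' : N ≤ n := le_max_right _ _
    have hb := hn₀ n hn₀'
    have hr := hm₀ n hm₀'
    have hw := hN n hN'
    have heq : (Literature.Computability.Complexity.formulaSizeOver Literature.Computability.Complexity.monotoneBasis
        (fun a : Fin n × Fin n → Bool => decide (∃ mo ∈ (Literature.Computability.AlgebraicComplexity.perPoly (Fin n) ℂ).support,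
          ∀ i ∈ mo.support, a i = true)) : ℝ)
          = Literature.Computability.Complexity.formulaSizeOver Literature.Computability.Complexity.monotoneBasis
              (Literature.Barriers.PneNP.perfectMatchingFn n) := by
      rw [shadow_eq]
    have hb' : (Literature.Computability.Complexity.formulaSizeOver Literature.Computability.Complexity.monotoneBasis
        (Literature.Barriers.PneNP.perfectMatchingFn n) : ℝ)
        ≤ 2 ^ (((Literature.Computability.AlgebraicComplexity.perPoly (Fin n) ℂ).totalDegree : ℝ) ^ (1 - δ) *
            Real.log (n + 2) ^ C + C) := by
      rw [← heq]; exact hb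
    have hchain := hr.trans hb'
    rw [Real.rpow_le_rpow_left_iff (by norm_num : (1 : ℝ) < 2)] at hchain
    rw [totalDegree_perPoly] at hchain
    linarith
  exact Summit.ValiantsHypothesis.Hub.valiantsHypothesis_of_not_isVPFamily_per hnotVP
    (Literature.Computability.AlgebraicComplexity.mem_VP_ofFintype_iff_holds _)
    (Literature.Computability.AlgebraicComplexity.perFamily_mem_VNP_holds ℂ)

end Summit.ValiantsHypothesis.ValiantsHypothesis.Theses.ShallowShadows
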